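import Summits.ABC.ABC.Theses.IneffectiveSubspace

/-!
# `DeepRegimeABC` (stmt-ABC-15121): a soundness-proved checker for censuses of the deep cells

Infrastructure for compute-certificates of the crux
`Summit.ABC.ABC.Theses.IneffectiveSubspace.DeepRegimeABC` (abc with exponent `1 + ε` on the
`ε`-dependent deep tail `{ω₅(abc) ≥ K(ε)}`, `ω₅(n) := #{p : p⁵ ∣ n}`), refuter compute seat
`ccert-stmt-ABC-15121` (2026-08-16).  This file is axiom-standard (no compiled evaluation); the
certificate runs (`native_decide` on closed instances of `censusCheck`) live in
`Negative/CensusBelowTenPowSeven.lean`.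

**The checker `censusCheck K N P L`** and its soundness theorem `census_sound'`: if it returns `true`,
`P` is duplicate-free and contains every prime `p` with `p⁵ ≤ N`, then every abc triple `a + b = c ≤ N`
with `ω₅(abc) ≥ K` and `rad(abc) < c` is listed in `L` (as `(a, b, c)` or `(b, a, c)`).

**Method.** If `ω₅(abc) ≥ K`, pick `K` primes `p` with `p⁵ ∣ abc`; by pairwise coprimality each `p⁵`
divides exactly one member (`pow_dvd_member_of_pow_dvd_abc`), so some ordered splitting `(A, B, C)` of
these primes (`splits`, `splits_spec`) has `A⁵ ∣ a`, `B⁵ ∣ b`, `C⁵ ∣ c`, and each such prime has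
`p⁵ ≤ c ≤ N`, hence lies in `P`.  The checker ranges over all `K`-sublists `T` of `P`, all splittings of
`T`, and all lattice points `A⁵ ∣ a`, `B⁵ ∣ b`, `C⁵ ∣ a + b ≤ N` (iterating the two members with the
largest moduli: `comboOK`, `allMul`), and checks (`pointOK`) that every point with `a < b`,
`gcd(a, b) = 1` and `rad a · rad b · rad(a + b) < a + b` (computable radical `radC = radical`) is listed.
-/

-- `Summit.<Summit>.<Problem>` is the mandated summit-side namespace (CONVENTIONS §2); for the
-- single-conjunct summit `ABC` the two coincide, so the duplicate `ABC.ABC` is deliberate.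
set_option linter.dupNamespace false

namespace Summit.ABC.ABC.Theorems.DeepRegimeABC.Negative

open Literature.NumberTheory.DiophantineGeometry UniqueFactorizationMonoid

/-! ## The checker -/

/-- Computable radical: the product of the distinct primes of `n` (`= radical n`, `radC_eq`). [folklore] -/
def radC (n : ℕ) : ℕ := ∏ p ∈ n.primeFactors, p

/-- `radC n = radical n`. [folklore] -/
theorem radC_eq (n : ℕ) : radC n = radical n := Nat.radical_eq_prod_primeFactors.symm

/-- `allMul M N f`: `f` holds at every positive multiple `M·i ≤ N` of `M`. [folklore] -/
def allMul (M N : ℕ) (f : ℕ → Bool) : Bool :=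
  (List.range (N / M + 1)).all fun i => i == 0 || f (M * i)

/-- Soundness of `allMul`. [folklore] -/
theorem allMul_spec {M N : ℕ} {f : ℕ → Bool} (h : allMul M N f = true) {x : ℕ} (hM : M ∣ x)
    (hx0 : 0 < x) (hxN : x ≤ N) : f x = true := by
  obtain ⟨i, rfl⟩ := hM
  have hMpos : 0 < M := Nat.pos_of_ne_zero fun h0 => by simp [h0] at hx0
  have hi0 : i ≠ 0 := fun h0 => by simp [h0] at hx0
  have hi : i ≤ N / M := (Nat.le_div_iff_mul_le hMpos).mpr (by simpa [mul_comm] using hxN)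
  unfold allMul at h
  rw [List.all_eq_true] at h
  have := h i (List.mem_range.mpr (Nat.lt_succ_of_le hi))
  simpa [hi0] using this

/-- One lattice point `(a, b, a + b)` passes iff it is not an ordered coprime hit, or it is listed.
[folklore] -/
def pointOK (L : List (ℕ × ℕ × ℕ)) (a b : ℕ) : Bool :=
  !decide (a < b) || !(Nat.gcd a b == 1) || !decide (radC a * radC b * radC (a + b) < a + b) ||
    decide ((a, b, a + b) ∈ L)

/-- All lattice points `MA ∣ a`, `MB ∣ b`, `MC ∣ a + b`, `0 < a`, `0 < b`, `a + b ≤ N` pass `pointOK`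
(iterate the two members with the largest moduli; the third is determined). [folklore] -/
def comboOK (L : List (ℕ × ℕ × ℕ)) (N MA MB MC : ℕ) : Bool :=
  if N < MA ∨ N < MB ∨ N < MC then true
  else if MC ≤ MA ∧ MC ≤ MB then
    allMul MA N fun a => allMul MB (N - a) fun b => !decide (MC ∣ a + b) || pointOK L a b
  else if MB ≤ MA ∧ MB ≤ MC then
    allMul MA N fun a => allMul MC N fun c => !decide (a < c) || !decide (MB ∣ c - a) ||
      pointOK L a (c - a)
  else
    allMul MB N fun b => allMul MC N fun c => !decide (b < c) || !decide (MA ∣ c - b) ||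
      pointOK L (c - b) b

/-- Soundness of `comboOK`. [folklore] -/
theorem comboOK_spec {L : List (ℕ × ℕ × ℕ)} {N MA MB MC : ℕ} (h : comboOK L N MA MB MC = true)
    {a b : ℕ} (ha : 0 < a) (hb : 0 < b) (hN : a + b ≤ N) (hA : MA ∣ a) (hB : MB ∣ b)
    (hC : MC ∣ a + b) : pointOK L a b = true := by
  unfold comboOK at h
  split_ifs at h with h0 h1 h2
  · exfalso
    rcases h0 with h0 | h0 | h0
    · exact absurd ((Nat.le_of_dvd ha hA).trans (by omega)) (not_le.mpr h0)
    · exact absurd ((Nat.le_of_dvd hb hB).trans (by omega)) (not_le.mpr h0)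
    · exact absurd ((Nat.le_of_dvd (by omega) hC).trans hN) (not_le.mpr h0)
  · have h' := allMul_spec h hA ha (by omega)
    have h'' := allMul_spec h' hB hb (by omega)
    simpa [hC] using h''
  · have h' := allMul_spec h hA ha (by omega)
    have h'' := allMul_spec h' hC (by omega) hN
    have hlt : a < a + b := by omega
    simpa [hlt, hB, Nat.add_sub_cancel_left] using h''
  · have h' := allMul_spec h hB hb (by omega)
    have h'' := allMul_spec h' hC (by omega) hN
    have hlt : b < a + b := by omega
    simpa [hlt, hA, Nat.add_sub_cancel] using h''

/-- All ordered splittings of a list of primes into three products `(A, B, C)`. [folklore] -/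
def splits : List ℕ → List (ℕ × ℕ × ℕ)
  | [] => [(1, 1, 1)]
  | p :: t => (splits t).flatMap fun x =>
      [(p * x.1, x.2.1, x.2.2), (x.1, p * x.2.1, x.2.2), (x.1, x.2.1, p * x.2.2)]

/-- Soundness of `splits`: if each prime of a duplicate-free list `T` has its fifth power dividing
`a`, `b` or `c`, some splitting `(A, B, C)` of `T` has `A⁵ ∣ a`, `B⁵ ∣ b`, `C⁵ ∣ c`. [folklore] -/
theorem splits_spec (T : List ℕ) (hT : T.Nodup) (hprime : ∀ p ∈ T, p.Prime) (a b c : ℕ)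
    (h : ∀ p ∈ T, p ^ 5 ∣ a ∨ p ^ 5 ∣ b ∨ p ^ 5 ∣ c) :
    ∃ x ∈ splits T, x.1 ^ 5 ∣ a ∧ x.2.1 ^ 5 ∣ b ∧ x.2.2 ^ 5 ∣ c ∧ x.1 * x.2.1 * x.2.2 = T.prod := by
  induction T with
  | nil => exact ⟨(1, 1, 1), by simp [splits], by simp, by simp, by simp, by simp⟩
  | cons p t ih =>
    have hpt : p ∉ t := (List.nodup_cons.mp hT).1
    have hp : p.Prime := hprime p (by simp)
    obtain ⟨x, hx, hxa, hxb, hxc, hprod⟩ := ih (List.nodup_cons.mp hT).2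
      (fun q hq => hprime q (by simp [hq])) (fun q hq => h q (by simp [hq]))
    -- `p` is coprime to each component of `x` (their product is `t.prod`, and `p ∉ t`)
    have hcopT : Nat.Coprime p t.prod :=
      Nat.coprime_list_prod_right_iff.mpr fun q hq =>
        (Nat.coprime_primes hp (hprime q (by simp [hq]))).mpr fun hpq => hpt (hpq ▸ hq)
    have hcop1 : Nat.Coprime p x.1 :=
      Nat.Coprime.coprime_dvd_right ⟨x.2.1 * x.2.2, by rw [← hprod]; ring⟩ hcopT
    have hcop2 : Nat.Coprime p x.2.1 :=
      Nat.Coprime.coprime_dvd_right ⟨x.1 * x.2.2, by rw [← hprod]; ring⟩ hcopT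
    have hcop3 : Nat.Coprime p x.2.2 :=
      Nat.Coprime.coprime_dvd_right ⟨x.1 * x.2.1, by rw [← hprod]; ring⟩ hcopT
    have hmem : ∀ y ∈ [(p * x.1, x.2.1, x.2.2), (x.1, p * x.2.1, x.2.2), (x.1, x.2.1, p * x.2.2)],
        y ∈ splits (p :: t) := fun y hy => by
      simp only [splits, List.mem_flatMap]
      exact ⟨x, hx, hy⟩
    rcases h p (by simp) with hpa | hpb | hpc
    · refine ⟨(p * x.1, x.2.1, x.2.2), hmem _ (by simp), ?_, hxb, hxc, by
        simp only [List.prod_cons, ← hprod]; ring⟩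
      simpa [mul_pow] using Nat.Coprime.mul_dvd_of_dvd_of_dvd (hcop1.pow 5 5) hpa hxa
    · refine ⟨(x.1, p * x.2.1, x.2.2), hmem _ (by simp), hxa, ?_, hxc, by
        simp only [List.prod_cons, ← hprod]; ring⟩
      simpa [mul_pow] using Nat.Coprime.mul_dvd_of_dvd_of_dvd (hcop2.pow 5 5) hpb hxb
    · refine ⟨(x.1, x.2.1, p * x.2.2), hmem _ (by simp), hxa, hxb, ?_, by
        simp only [List.prod_cons, ← hprod]; ring⟩
      simpa [mul_pow] using Nat.Coprime.mul_dvd_of_dvd_of_dvd (hcop3.pow 5 5) hpc hxc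

/-- The census checker: for every `K`-sublist `T` of the prime list `P`, every splitting `(A, B, C)`
of `T`, and every lattice point `A⁵ ∣ a`, `B⁵ ∣ b`, `C⁵ ∣ a + b ≤ N`: `pointOK`. [folklore] -/
def censusCheck (K N : ℕ) (P : List ℕ) (L : List (ℕ × ℕ × ℕ)) : Bool :=
  (P.sublists.filter fun T => T.length == K).all fun T =>
    (splits T).all fun x => comboOK L N (x.1 ^ 5) (x.2.1 ^ 5) (x.2.2 ^ 5)

/-! ## Soundness of the checker -/

/-- For an abc triple, `rad a · rad b · rad c = rad(abc)` (pairwise coprimality). [folklore] -/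
theorem radC_mul_three {a b c : ℕ} (h : IsABCTriple a b c) :
    radC a * radC b * radC c = rad a b c := by
  obtain ⟨-, -, habc, hcop⟩ := h
  have hac : Nat.Coprime a c := by
    rw [← habc, add_comm]
    exact Nat.coprime_add_self_right.mpr hcop
  have hbc : Nat.Coprime b c := by
    rw [← habc]
    exact Nat.coprime_add_self_right.mpr hcop.symm
  have habc' : Nat.Coprime (a * b) c := Nat.Coprime.mul_left hac hbc
  rw [radC_eq, radC_eq, radC_eq, rad_def, radical_mul (Nat.coprime_iff_isRelPrime.mp habc'),
    radical_mul (Nat.coprime_iff_isRelPrime.mp hcop)]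

/-- In an abc triple a prime fifth power dividing `abc` divides one member. [folklore] -/
theorem pow_dvd_member_of_pow_dvd_abc {a b c p : ℕ} (h : IsABCTriple a b c) (hp : p.Prime)
    (hd : p ^ 5 ∣ a * b * c) : p ^ 5 ∣ a ∨ p ^ 5 ∣ b ∨ p ^ 5 ∣ c := by
  obtain ⟨-, -, habc, hcop⟩ := h
  have hac : Nat.Coprime a c := by
    rw [← habc, add_comm]
    exact Nat.coprime_add_self_right.mpr hcop
  have hbc : Nat.Coprime b c := by
    rw [← habc]
    exact Nat.coprime_add_self_right.mpr hcop.symm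
  have hpd : p ∣ a * b * c := dvd_trans (dvd_pow_self p (by norm_num)) hd
  have cop_of_ndvd : ∀ {m : ℕ}, ¬ p ∣ m → Nat.Coprime (p ^ 5) m := fun hm =>
    Nat.Coprime.pow_left 5 ((Nat.Prime.coprime_iff_not_dvd hp).mpr hm)
  rcases (Nat.Prime.dvd_mul hp).mp hpd with hpab | hpc
  · rcases (Nat.Prime.dvd_mul hp).mp hpab with hpa | hpb
    · have hnb : ¬ p ∣ b := fun hpb => hp.one_lt.ne' (Nat.eq_one_of_dvd_coprimes hcop hpa hpb)
      have hnc : ¬ p ∣ c := fun hpc => hp.one_lt.ne' (Nat.eq_one_of_dvd_coprimes hac hpa hpc)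
      left
      have h' : p ^ 5 ∣ a * (b * c) := by simpa [mul_assoc] using hd
      exact (Nat.Coprime.mul_right (cop_of_ndvd hnb) (cop_of_ndvd hnc)).dvd_of_dvd_mul_right h'
    · have hna : ¬ p ∣ a := fun hpa => hp.one_lt.ne' (Nat.eq_one_of_dvd_coprimes hcop hpa hpb)
      have hnc : ¬ p ∣ c := fun hpc => hp.one_lt.ne' (Nat.eq_one_of_dvd_coprimes hbc hpb hpc)
      right; left
      have h' : p ^ 5 ∣ b * (a * c) := by
        simpa [mul_comm, mul_assoc, mul_left_comm] using hd
      exact (Nat.Coprime.mul_right (cop_of_ndvd hna) (cop_of_ndvd hnc)).dvd_of_dvd_mul_right h'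
  · have hna : ¬ p ∣ a := fun hpa => hp.one_lt.ne' (Nat.eq_one_of_dvd_coprimes hac hpa hpc)
    have hnb : ¬ p ∣ b := fun hpb => hp.one_lt.ne' (Nat.eq_one_of_dvd_coprimes hbc hpb hpc)
    right; right
    have h' : p ^ 5 ∣ c * (a * b) := by simpa [mul_comm] using hd
    exact (Nat.Coprime.mul_right (cop_of_ndvd hna) (cop_of_ndvd hnb)).dvd_of_dvd_mul_right h'

/-- **Soundness of the census checker** (ordered form `a < b`).  If `censusCheck K N P L` passes,
`P` is duplicate-free and contains every prime `p` with `p⁵ ≤ N`, then every abc triple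
`a + b = c ≤ N` with `a < b`, `ω₅(abc) ≥ K` and `rad(abc) < c` is listed in `L`. [folklore] -/
theorem census_sound (K N : ℕ) (P : List ℕ) (L : List (ℕ × ℕ × ℕ)) (hPnd : P.Nodup)
    (hP : ∀ p : ℕ, p.Prime → p ^ 5 ≤ N → p ∈ P) (hchk : censusCheck K N P L = true)
    {a b c : ℕ} (habc : IsABCTriple a b c) (hcN : c ≤ N)
    (hK : K ≤ ((a * b * c).primeFactors.filter (fun p => 5 ≤ (a * b * c).factorization p)).card)
    (hhit : rad a b c < c) (hab : a < b) : (a, b, c) ∈ L := by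
  have ha : 0 < a := habc.1
  have hb : 0 < b := habc.2.1
  have hsum : a + b = c := habc.2.2.1
  have hcop : Nat.Coprime a b := habc.2.2.2
  have hn0 : a * b * c ≠ 0 := Nat.mul_ne_zero (Nat.mul_ne_zero ha.ne' hb.ne') (by omega)
  -- K deep primes
  obtain ⟨S, hSsub, hScard⟩ := Finset.exists_subset_card_eq hK
  have hSprime : ∀ p ∈ S, p.Prime := fun p hp =>
    Nat.prime_of_mem_primeFactors (Finset.mem_filter.mp (hSsub hp)).1
  have hSdvd : ∀ p ∈ S, p ^ 5 ∣ a ∨ p ^ 5 ∣ b ∨ p ^ 5 ∣ c := fun p hp => by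
    have hm := Finset.mem_filter.mp (hSsub hp)
    exact pow_dvd_member_of_pow_dvd_abc habc (hSprime p hp)
      (((hSprime p hp).pow_dvd_iff_le_factorization hn0).mpr hm.2)
  have hSP : ∀ p ∈ S, p ∈ P := fun p hp => by
    refine hP p (hSprime p hp) ?_
    rcases hSdvd p hp with h | h | h
    · exact (Nat.le_of_dvd ha h).trans (by omega)
    · exact (Nat.le_of_dvd hb h).trans (by omega)
    · exact (Nat.le_of_dvd (by omega) h).trans hcN
  -- the sublist of `P` carrying `S`
  set T : List ℕ := P.filter fun p => decide (p ∈ S) with hTdef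
  have hTmemS : ∀ p, p ∈ T ↔ p ∈ S := fun p => by
    simp only [hTdef, List.mem_filter, decide_eq_true_eq]
    exact ⟨fun h => h.2, fun h => ⟨hSP p h, h⟩⟩
  have hTnd : T.Nodup := hPnd.filter _
  have hTlen : T.length = K := by
    have h1 : T.toFinset = S := by
      ext p; rw [List.mem_toFinset]; exact hTmemS p
    rw [← List.toFinset_card_of_nodup hTnd, h1, hScard]
  have hTmem : T ∈ P.sublists.filter fun T => T.length == K := by
    rw [List.mem_filter]
    exact ⟨List.mem_sublists.mpr List.filter_sublist, by simp [hTlen]⟩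
  -- run the checker on `T` and the splitting of `S` induced by `(a, b, c)`
  unfold censusCheck at hchk
  rw [List.all_eq_true] at hchk
  have hT := hchk T hTmem
  rw [List.all_eq_true] at hT
  obtain ⟨x, hx, hxa, hxb, hxc, -⟩ := splits_spec T hTnd (fun p hp => hSprime p ((hTmemS p).mp hp))
    a b c (fun p hp => hSdvd p ((hTmemS p).mp hp))
  have hcombo := hT x hx
  have hpt := comboOK_spec hcombo ha hb (by omega) hxa hxb (by simpa [hsum] using hxc)
  -- read the point check back
  have hgcd : Nat.gcd a b = 1 := hcop
  have hrad : radC a * radC b * radC (a + b) < a + b := by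
    rw [hsum, radC_mul_three habc]; exact hhit
  unfold pointOK at hpt
  simp only [hab, decide_true, Bool.not_true, hgcd, beq_self_eq_true, hrad, Bool.false_or,
    decide_eq_true_eq] at hpt
  simpa [hsum] using hpt

/-- **Soundness of the census checker** (unordered form). [folklore] -/
theorem census_sound' (K N : ℕ) (P : List ℕ) (L : List (ℕ × ℕ × ℕ)) (hPnd : P.Nodup)
    (hP : ∀ p : ℕ, p.Prime → p ^ 5 ≤ N → p ∈ P) (hchk : censusCheck K N P L = true)
    {a b c : ℕ} (habc : IsABCTriple a b c) (hcN : c ≤ N)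
    (hK : K ≤ ((a * b * c).primeFactors.filter (fun p => 5 ≤ (a * b * c).factorization p)).card)
    (hhit : rad a b c < c) : (a, b, c) ∈ L ∨ (b, a, c) ∈ L := by
  obtain ⟨ha, hb, hsum, hcop⟩ := habc
  rcases Nat.lt_trichotomy a b with hab | hab | hab
  · exact Or.inl (census_sound K N P L hPnd hP hchk ⟨ha, hb, hsum, hcop⟩ hcN hK hhit hab)
  · -- `a = b` is impossible: coprimality forces `a = b = 1`, `c = 2`, `rad = 2 = c`
    exfalso
    subst hab
    have ha1 : a = 1 := by simpa [Nat.coprime_self] using hcop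
    subst ha1
    have hc2 : c = 2 := by omega
    subst hc2
    have h1 : radical (1 * 1 * 2) ≤ 1 := by
      have := hhit; rw [rad_def] at this; omega
    have := Nat.radical_le_one_iff.mp h1
    omega
  · have habc' : IsABCTriple b a c := ⟨hb, ha, by omega, hcop.symm⟩
    have hK' : K ≤ ((b * a * c).primeFactors.filter
        (fun p => 5 ≤ (b * a * c).factorization p)).card := by rwa [mul_comm b a]
    have hhit' : rad b a c < c := by
      rw [rad_def, mul_comm b a]; rw [rad_def] at hhit; exact hhit
    exact Or.inr (census_sound K N P L hPnd hP hchk habc' hcN hK' hhit' hab)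

end Summit.ABC.ABC.Theorems.DeepRegimeABC.Negative
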